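import Summits.ValiantsHypothesis.ValiantsHypothesis.Theorems.NcPalindromePower
import HarnessLib

/-!
# The unbalance dial is strict, upper side: small unbalanced circuits for powers of palindromes

Workshop file for the node `CommutativityDial` (decomp-valiant lens 6 «restricted-models lifting axis»;
offer O-L6-14 «THE UNBALANCE DIAL IS STRICT», FILE 2 of 2; FILE 1 = `NcPalindromePower`).
Limaye–Malod–Srinivasan (ToC 12 (2016), §1 p. 7): the square of a palindrome polynomial "can be
computed by a small circuit with just a single non-skew gate; this also gives an exponential
separation between skew circuits and circuits with one non-skew gate". Here, for every power
`k = j + 2` and over every commutative semiring, an explicit fan-in-two noncommutative circuit of size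
`≤ 5t + j + 1` computes `PAL_t^{j+2}` and satisfies LMS16's Def. 5.6 READ SEMANTICALLY with
`δ = w + 1` for every notch `w ≥ 2t − 1` (at every product gate one operand's value has all components
of degrees `w + 2 ≤ b ≤ d + 1` equal to zero): the nested palindrome `PAL_t` is built with `5t` gates
each of whose product gates has a LETTER operand (`x · (PAL_i · x)`), and the powers
`PAL_t^{i+1} = PAL_t^i · PAL_t` multiply by the homogeneous degree-`2t` value `PAL_t`.

* §1 the closure of the semantic Def. 5.6 under appending one gate (`hdeg_append`) and the four
  appending steps used (`extend_mul_var`, `extend_var_mul`, `extend_add`, `extend_mul_small`);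
* §2 the circuits for `PAL_t` (`avail_palPoly`) and its powers (`avail_palPow`);
* §3 **THE WITNESS** (`exists_unbalanced_palPow`);
* §4 **THE DIAL IS STRICT** (`palPow_dial_two_sided`): with FILE 1, at degree `d = 2(s+1)(j+2)` the
  family `PAL_{s+1}^{j+2}` has `(2s+3)`-unbalanced circuits of size `≤ 5(s+1) + j + 1`, while every
  `(w+2)`-unbalanced circuit has size `≥ 2^{s+1} / ((s+2)(w+1)2^w)` and every skew circuit size
  `≥ 2^{s+1} / (s+2)` — each notch of the dial is a strictly stronger model.

HONEST FRAMING: restricted models only; `A_nc` (stmt-23446), `D2`, `per_n` / `det_n` lower bounds for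
general nc circuits, `VP ≠ VNP` untouched and proved by nothing here; mechanism PRINT (Nisan 1991;
LMS16 §1 p7 remark, Def 5.6, Cor 5.7, Thm 5.5); the general power `j+2` and the explicit constants are
bookkeeping (explicit sizes new only in the kernel).
-/

noncomputable section

namespace Summit.ValiantsHypothesis.ValiantsHypothesis.Theorems.NcPalindromePowerWitness

open Literature.Computability.AlgebraicComplexity Literature.Computability.AlgebraicComplexity.ArithCircuit
open Summit.ValiantsHypothesis.ValiantsHypothesis.Theorems.NcAutomatonIntersection
  Summit.ValiantsHypothesis.ValiantsHypothesis.Theorems.NcCentralWidth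
  Summit.ValiantsHypothesis.ValiantsHypothesis.Theorems.NcSOSDegreeFour
  Summit.ValiantsHypothesis.ValiantsHypothesis.Theorems.NcBlockForms
  Summit.ValiantsHypothesis.ValiantsHypothesis.Theorems.NcCayleyDeterminant
  Summit.ValiantsHypothesis.ValiantsHypothesis.Theorems.NcSOSPermanent
  Summit.ValiantsHypothesis.ValiantsHypothesis.Theorems.NcSkewStructure
  Summit.ValiantsHypothesis.ValiantsHypothesis.Theorems.NcSkewPermanent
  Summit.ValiantsHypothesis.ValiantsHypothesis.Theorems.NcUnbalancedStructure
  Summit.ValiantsHypothesis.ValiantsHypothesis.Theorems.NcUnbalancedRank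
  Summit.ValiantsHypothesis.ValiantsHypothesis.Theorems.NcPalindromePower

universe u v

/-! ## §1 Appending gates under the semantic Def. 5.6 -/

section Toolkit

variable {R : Type u} [CommSemiring R] {σ : Type v}

/-- The empty program satisfies Def. 5.6 (semantic form, `δ = w + 1`). [cite: LimayeMalodSrinivasan2016, Def. 5.6] -/
theorem hdeg_nil (w d : ℕ) :
    ∀ (l₁ : List (Gate R σ)) (o o' : Operand R σ) (l₂ : List (Gate R σ)),
      ([] : List (Gate R σ)) = l₁ ++ Gate.prod [o, o'] :: l₂ →
        (∀ b : ℕ, w + 2 ≤ b → b ≤ d + 1 → degPart d b (o.ncEval (ncGateValues l₁)) = 0) ∨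
        (∀ b : ℕ, w + 2 ≤ b → b ≤ d + 1 → degPart d b (o'.ncEval (ncGateValues l₁)) = 0) :=
  fun l₁ o o' l₂ h => by simp at h

/-- **Closure under appending**: if `gs` satisfies the semantic Def. 5.6 and the appended gate, when
it is a binary product, has an operand whose value (read after `gs`) has all components of degrees
`w + 2 ≤ b ≤ d + 1` equal to zero, then `gs ++ [g]` satisfies it. [cite: LimayeMalodSrinivasan2016, Def. 5.6] -/
theorem hdeg_append {w d : ℕ} {gs : List (Gate R σ)}
    (hgs : ∀ (l₁ : List (Gate R σ)) (o o' : Operand R σ) (l₂ : List (Gate R σ)),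
      gs = l₁ ++ Gate.prod [o, o'] :: l₂ →
        (∀ b : ℕ, w + 2 ≤ b → b ≤ d + 1 → degPart d b (o.ncEval (ncGateValues l₁)) = 0) ∨
        (∀ b : ℕ, w + 2 ≤ b → b ≤ d + 1 → degPart d b (o'.ncEval (ncGateValues l₁)) = 0))
    (g : Gate R σ)
    (hg : ∀ o o' : Operand R σ, g = Gate.prod [o, o'] →
      (∀ b : ℕ, w + 2 ≤ b → b ≤ d + 1 → degPart d b (o.ncEval (ncGateValues gs)) = 0) ∨
      (∀ b : ℕ, w + 2 ≤ b → b ≤ d + 1 → degPart d b (o'.ncEval (ncGateValues gs)) = 0)) :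
    ∀ (l₁ : List (Gate R σ)) (o o' : Operand R σ) (l₂ : List (Gate R σ)),
      gs ++ [g] = l₁ ++ Gate.prod [o, o'] :: l₂ →
        (∀ b : ℕ, w + 2 ≤ b → b ≤ d + 1 → degPart d b (o.ncEval (ncGateValues l₁)) = 0) ∨
        (∀ b : ℕ, w + 2 ≤ b → b ≤ d + 1 → degPart d b (o'.ncEval (ncGateValues l₁)) = 0) := by
  intro l₁ o o' l₂ h
  rcases List.append_eq_append_iff.mp h with ⟨a', h1, h2⟩ | ⟨c', h1, h2⟩
  · cases a' with
    | nil =>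
      simp only [List.nil_append, List.cons.injEq] at h2
      rw [List.append_nil] at h1
      subst h1
      exact hg o o' h2.1
    | cons y tl => simp at h2
  · cases c' with
    | nil =>
      simp only [List.nil_append, List.cons.injEq] at h2
      rw [List.append_nil] at h1
      subst h1
      exact hg o o' h2.1.symm
    | cons y tl =>
      simp only [List.cons_append, List.cons.injEq] at h2
      rw [← h2.1] at h1
      exact hgs l₁ o o' tl h1

/-- A LETTER operand has no component at any index `2 ≤ b ≤ d + 1`, a fortiori none in
`[w + 2, d + 1]`. [cite: LimayeMalodSrinivasan2016, §5 (skew ⊂ unbalanced)] -/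
theorem small_var (vals : List (FreeAlgebra R σ)) (x : σ) {w d : ℕ} :
    ∀ b : ℕ, w + 2 ≤ b → b ≤ d + 1 → degPart d b ((Operand.var x : Operand R σ).ncEval vals) = 0 :=
  fun b hb hbd => degPart_ι_eq_zero' (by omega) hbd x

/-- An operand whose value is homogeneous of degree `c ≤ w + 1` has no component in `[w + 2, d + 1]`.
[cite: LimayeMalodSrinivasan2016, Def. 5.6] -/
theorem small_of_degPart {vals : List (FreeAlgebra R σ)} {u : Operand R σ} {q : FreeAlgebra R σ}
    {c w d : ℕ} (hu : u.ncEval vals = q) (hq : degPart d c q = q) (hcw : c ≤ w + 1)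
    (hcd : c ≤ d + 1) :
    ∀ b : ℕ, w + 2 ≤ b → b ≤ d + 1 → degPart d b (u.ncEval vals) = 0 := by
  intro b hb hbd
  rw [hu, ← hq]
  exact degPart_degPart_of_ne (by omega) hcd hbd q

/-- Appending `p · x` (`x` a LETTER): one fan-in-two gate, Def. 5.6 kept at every notch.
[cite: LimayeMalodSrinivasan2016, §1 (remark on `PAL²`)] -/
theorem extend_mul_var {w d : ℕ} {gs : List (Gate R σ)} (h2 : ∀ g ∈ gs, g.fanIn ≤ 2)
    (hd : ∀ (l₁ : List (Gate R σ)) (o o' : Operand R σ) (l₂ : List (Gate R σ)),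
      gs = l₁ ++ Gate.prod [o, o'] :: l₂ →
        (∀ b : ℕ, w + 2 ≤ b → b ≤ d + 1 → degPart d b (o.ncEval (ncGateValues l₁)) = 0) ∨
        (∀ b : ℕ, w + 2 ≤ b → b ≤ d + 1 → degPart d b (o'.ncEval (ncGateValues l₁)) = 0))
    {p : FreeAlgebra R σ}
    (hp : ∃ u : Operand R σ, u.RefsBelow gs.length ∧ u.ncEval (ncGateValues gs) = p) (x : σ) :
    ∃ gs' : List (Gate R σ), gs <+: gs' ∧ (∀ g ∈ gs', g.fanIn ≤ 2) ∧
      (∀ (l₁ : List (Gate R σ)) (o o' : Operand R σ) (l₂ : List (Gate R σ)),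
        gs' = l₁ ++ Gate.prod [o, o'] :: l₂ →
          (∀ b : ℕ, w + 2 ≤ b → b ≤ d + 1 → degPart d b (o.ncEval (ncGateValues l₁)) = 0) ∨
          (∀ b : ℕ, w + 2 ≤ b → b ≤ d + 1 → degPart d b (o'.ncEval (ncGateValues l₁)) = 0)) ∧
      gs'.length ≤ gs.length + 1 ∧
      ∃ u : Operand R σ, u.RefsBelow gs'.length ∧
        u.ncEval (ncGateValues gs') = p * FreeAlgebra.ι R x := by
  obtain ⟨u, -, hu⟩ := hp
  refine ⟨gs ++ [Gate.prod [u, Operand.var x]], List.prefix_append _ _,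
    fanIn_append h2 (by simp [Gate.fanIn, Gate.args]), hdeg_append hd _ (fun o o' ho => ?_),
    by simp, Operand.gate gs.length, by simp [Operand.RefsBelow], ?_⟩
  · have ho' : u = o ∧ Operand.var x = o' := by simpa using ho
    rcases ho' with ⟨-, rfl⟩
    exact Or.inr (small_var (ncGateValues gs) x)
  · have hx : (Operand.var x : Operand R σ).ncEval (ncGateValues gs) = FreeAlgebra.ι R x := rfl
    rw [ncEval_gate, ncGateValues_getD_length]
    simp [Gate.ncEval, hu, hx]

/-- Appending `x · p` (`x` a LETTER): one fan-in-two gate, Def. 5.6 kept at every notch.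
[cite: LimayeMalodSrinivasan2016, §1 (remark on `PAL²`)] -/
theorem extend_var_mul {w d : ℕ} {gs : List (Gate R σ)} (h2 : ∀ g ∈ gs, g.fanIn ≤ 2)
    (hd : ∀ (l₁ : List (Gate R σ)) (o o' : Operand R σ) (l₂ : List (Gate R σ)),
      gs = l₁ ++ Gate.prod [o, o'] :: l₂ →
        (∀ b : ℕ, w + 2 ≤ b → b ≤ d + 1 → degPart d b (o.ncEval (ncGateValues l₁)) = 0) ∨
        (∀ b : ℕ, w + 2 ≤ b → b ≤ d + 1 → degPart d b (o'.ncEval (ncGateValues l₁)) = 0))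
    {p : FreeAlgebra R σ}
    (hp : ∃ u : Operand R σ, u.RefsBelow gs.length ∧ u.ncEval (ncGateValues gs) = p) (x : σ) :
    ∃ gs' : List (Gate R σ), gs <+: gs' ∧ (∀ g ∈ gs', g.fanIn ≤ 2) ∧
      (∀ (l₁ : List (Gate R σ)) (o o' : Operand R σ) (l₂ : List (Gate R σ)),
        gs' = l₁ ++ Gate.prod [o, o'] :: l₂ →
          (∀ b : ℕ, w + 2 ≤ b → b ≤ d + 1 → degPart d b (o.ncEval (ncGateValues l₁)) = 0) ∨
          (∀ b : ℕ, w + 2 ≤ b → b ≤ d + 1 → degPart d b (o'.ncEval (ncGateValues l₁)) = 0)) ∧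
      gs'.length ≤ gs.length + 1 ∧
      ∃ u : Operand R σ, u.RefsBelow gs'.length ∧
        u.ncEval (ncGateValues gs') = FreeAlgebra.ι R x * p := by
  obtain ⟨u, -, hu⟩ := hp
  refine ⟨gs ++ [Gate.prod [Operand.var x, u]], List.prefix_append _ _,
    fanIn_append h2 (by simp [Gate.fanIn, Gate.args]), hdeg_append hd _ (fun o o' ho => ?_),
    by simp, Operand.gate gs.length, by simp [Operand.RefsBelow], ?_⟩
  · have ho' : Operand.var x = o ∧ u = o' := by simpa using ho
    rcases ho' with ⟨rfl, -⟩
    exact Or.inl (small_var (ncGateValues gs) x)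
  · have hx : (Operand.var x : Operand R σ).ncEval (ncGateValues gs) = FreeAlgebra.ι R x := rfl
    rw [ncEval_gate, ncGateValues_getD_length]
    simp [Gate.ncEval, hu, hx]

/-- Appending `p + q`: one fan-in-two SUM gate (no condition). [cite: LimayeMalodSrinivasan2016, Def. 5.6] -/
theorem extend_add {w d : ℕ} {gs : List (Gate R σ)} (h2 : ∀ g ∈ gs, g.fanIn ≤ 2)
    (hd : ∀ (l₁ : List (Gate R σ)) (o o' : Operand R σ) (l₂ : List (Gate R σ)),
      gs = l₁ ++ Gate.prod [o, o'] :: l₂ →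
        (∀ b : ℕ, w + 2 ≤ b → b ≤ d + 1 → degPart d b (o.ncEval (ncGateValues l₁)) = 0) ∨
        (∀ b : ℕ, w + 2 ≤ b → b ≤ d + 1 → degPart d b (o'.ncEval (ncGateValues l₁)) = 0))
    {p q : FreeAlgebra R σ}
    (hp : ∃ u : Operand R σ, u.RefsBelow gs.length ∧ u.ncEval (ncGateValues gs) = p)
    (hq : ∃ u : Operand R σ, u.RefsBelow gs.length ∧ u.ncEval (ncGateValues gs) = q) :
    ∃ gs' : List (Gate R σ), gs <+: gs' ∧ (∀ g ∈ gs', g.fanIn ≤ 2) ∧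
      (∀ (l₁ : List (Gate R σ)) (o o' : Operand R σ) (l₂ : List (Gate R σ)),
        gs' = l₁ ++ Gate.prod [o, o'] :: l₂ →
          (∀ b : ℕ, w + 2 ≤ b → b ≤ d + 1 → degPart d b (o.ncEval (ncGateValues l₁)) = 0) ∨
          (∀ b : ℕ, w + 2 ≤ b → b ≤ d + 1 → degPart d b (o'.ncEval (ncGateValues l₁)) = 0)) ∧
      gs'.length ≤ gs.length + 1 ∧
      ∃ u : Operand R σ, u.RefsBelow gs'.length ∧ u.ncEval (ncGateValues gs') = p + q := by
  obtain ⟨u, -, hu⟩ := hp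
  obtain ⟨v, -, hv⟩ := hq
  refine ⟨gs ++ [Gate.sum [((1 : R), u), ((1 : R), v)]], List.prefix_append _ _,
    fanIn_append h2 (by simp [Gate.fanIn, Gate.args]), hdeg_append hd _ (fun o o' ho => by cases ho),
    by simp, Operand.gate gs.length, by simp [Operand.RefsBelow], ?_⟩
  rw [ncEval_gate, ncGateValues_getD_length]
  simp [Gate.ncEval, hu, hv]

/-- Appending `p · q` where the operand of `q` evaluates to a homogeneous element of degree
`c ≤ w + 1`: one fan-in-two PRODUCT gate, Def. 5.6 kept at notch `w`. [cite: LimayeMalodSrinivasan2016, Def. 5.6] -/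
theorem extend_mul_small {w d c : ℕ} {gs : List (Gate R σ)} (h2 : ∀ g ∈ gs, g.fanIn ≤ 2)
    (hd : ∀ (l₁ : List (Gate R σ)) (o o' : Operand R σ) (l₂ : List (Gate R σ)),
      gs = l₁ ++ Gate.prod [o, o'] :: l₂ →
        (∀ b : ℕ, w + 2 ≤ b → b ≤ d + 1 → degPart d b (o.ncEval (ncGateValues l₁)) = 0) ∨
        (∀ b : ℕ, w + 2 ≤ b → b ≤ d + 1 → degPart d b (o'.ncEval (ncGateValues l₁)) = 0))
    {p q : FreeAlgebra R σ}
    (hp : ∃ u : Operand R σ, u.RefsBelow gs.length ∧ u.ncEval (ncGateValues gs) = p)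
    (hq : ∃ u : Operand R σ, u.RefsBelow gs.length ∧ u.ncEval (ncGateValues gs) = q)
    (hqc : degPart d c q = q) (hcw : c ≤ w + 1) (hcd : c ≤ d + 1) :
    ∃ gs' : List (Gate R σ), gs <+: gs' ∧ (∀ g ∈ gs', g.fanIn ≤ 2) ∧
      (∀ (l₁ : List (Gate R σ)) (o o' : Operand R σ) (l₂ : List (Gate R σ)),
        gs' = l₁ ++ Gate.prod [o, o'] :: l₂ →
          (∀ b : ℕ, w + 2 ≤ b → b ≤ d + 1 → degPart d b (o.ncEval (ncGateValues l₁)) = 0) ∨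
          (∀ b : ℕ, w + 2 ≤ b → b ≤ d + 1 → degPart d b (o'.ncEval (ncGateValues l₁)) = 0)) ∧
      gs'.length ≤ gs.length + 1 ∧
      ∃ u : Operand R σ, u.RefsBelow gs'.length ∧ u.ncEval (ncGateValues gs') = p * q := by
  obtain ⟨u, -, hu⟩ := hp
  obtain ⟨v, -, hv⟩ := hq
  refine ⟨gs ++ [Gate.prod [u, v]], List.prefix_append _ _,
    fanIn_append h2 (by simp [Gate.fanIn, Gate.args]), hdeg_append hd _ (fun o o' ho => ?_),
    by simp, Operand.gate gs.length, by simp [Operand.RefsBelow], ?_⟩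
  · have ho' : u = o ∧ v = o' := by simpa using ho
    rcases ho' with ⟨-, rfl⟩
    exact Or.inr (small_of_degPart hv hqc hcw hcd)
  · rw [ncEval_gate, ncGateValues_getD_length]
    simp [Gate.ncEval, hu, hv]

end Toolkit

/-! ## §2 The nested-palindrome circuit and its powers -/

section Build

variable (R : Type u) [CommSemiring R]

/-- **The circuit for `PAL_j`**: `5j` fan-in-two gates, by the recursion
`PAL_{i+1} = x₀ · (PAL_i · x₀) + x₁ · (PAL_i · x₁)`; every product gate has a LETTER operand, so
Def. 5.6 holds at EVERY notch `w` and every ambient degree `d`. [cite: Nisan1991Noncommutative, Lemma 1] -/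
theorem avail_palPoly (w d : ℕ) : ∀ j : ℕ, ∃ gs : List (Gate R (Fin 2)),
    (∀ g ∈ gs, g.fanIn ≤ 2) ∧
    (∀ (l₁ : List (Gate R (Fin 2))) (o o' : Operand R (Fin 2)) (l₂ : List (Gate R (Fin 2))),
      gs = l₁ ++ Gate.prod [o, o'] :: l₂ →
        (∀ b : ℕ, w + 2 ≤ b → b ≤ d + 1 → degPart d b (o.ncEval (ncGateValues l₁)) = 0) ∨
        (∀ b : ℕ, w + 2 ≤ b → b ≤ d + 1 → degPart d b (o'.ncEval (ncGateValues l₁)) = 0)) ∧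
    gs.length ≤ 5 * j ∧
    ∃ u : Operand R (Fin 2), u.RefsBelow gs.length ∧ u.ncEval (ncGateValues gs) = palPoly R j := by
  intro j
  induction j with
  | zero =>
    refine ⟨[], by simp, hdeg_nil w d, by simp, ?_⟩
    exact avail_congr (by rw [map_one, palPoly_zero]) (avail_const [] (1 : R))
  | succ j ih =>
    obtain ⟨gs, h2, hd, hlen, hav⟩ := ih
    obtain ⟨gs₁, hpre₁, h2₁, hd₁, hlen₁, hav₁⟩ := extend_mul_var h2 hd hav (0 : Fin 2)
    obtain ⟨gs₂, hpre₂, h2₂, hd₂, hlen₂, hav₂⟩ := extend_var_mul h2₁ hd₁ hav₁ (0 : Fin 2)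
    obtain ⟨gs₃, hpre₃, h2₃, hd₃, hlen₃, hav₃⟩ :=
      extend_mul_var h2₂ hd₂ (avail_mono (hpre₁.trans hpre₂) hav) (1 : Fin 2)
    obtain ⟨gs₄, hpre₄, h2₄, hd₄, hlen₄, hav₄⟩ := extend_var_mul h2₃ hd₃ hav₃ (1 : Fin 2)
    obtain ⟨gs₅, hpre₅, h2₅, hd₅, hlen₅, hav₅⟩ :=
      extend_add h2₄ hd₄ (avail_mono (hpre₃.trans hpre₄) hav₂) hav₄
    refine ⟨gs₅, h2₅, hd₅, by omega, avail_congr ?_ hav₅⟩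
    rw [palPoly_succ, Fin.sum_univ_two]
    simp only [mul_assoc]

/-- **The circuit for `PAL_t^{i+1}`**: `5t` gates for `PAL_t`, then `i` PRODUCT gates
`PAL_t^{i'+1} = PAL_t^{i'} · PAL_t`, each multiplying by the homogeneous degree-`2t` value `PAL_t` —
Def. 5.6 holds at every notch `w` with `2t ≤ w + 1`. [cite: LimayeMalodSrinivasan2016, §1 (remark on `PAL²`)] -/
theorem avail_palPow {t w d : ℕ} (hw : 2 * t ≤ w + 1) (htd : 2 * t ≤ d) : ∀ i : ℕ,
    ∃ gs : List (Gate R (Fin 2)), (∀ g ∈ gs, g.fanIn ≤ 2) ∧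
    (∀ (l₁ : List (Gate R (Fin 2))) (o o' : Operand R (Fin 2)) (l₂ : List (Gate R (Fin 2))),
      gs = l₁ ++ Gate.prod [o, o'] :: l₂ →
        (∀ b : ℕ, w + 2 ≤ b → b ≤ d + 1 → degPart d b (o.ncEval (ncGateValues l₁)) = 0) ∨
        (∀ b : ℕ, w + 2 ≤ b → b ≤ d + 1 → degPart d b (o'.ncEval (ncGateValues l₁)) = 0)) ∧
    gs.length ≤ 5 * t + i ∧
    (∃ u : Operand R (Fin 2), u.RefsBelow gs.length ∧ u.ncEval (ncGateValues gs) = palPoly R t) ∧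
    ∃ u : Operand R (Fin 2), u.RefsBelow gs.length ∧
      u.ncEval (ncGateValues gs) = palPoly R t ^ (i + 1) := by
  intro i
  induction i with
  | zero =>
    obtain ⟨gs, h2, hd, hlen, hav⟩ := avail_palPoly R w d t
    exact ⟨gs, h2, hd, by omega, hav, avail_congr (by simp) hav⟩
  | succ i ih =>
    obtain ⟨gs, h2, hd, hlen, hav, havi⟩ := ih
    obtain ⟨gs', hpre, h2', hd', hlen', hav'⟩ :=
      extend_mul_small h2 hd havi hav (degPart_palPoly R t htd) hw (by omega)
    exact ⟨gs', h2', hd', by omega, avail_mono hpre hav, avail_congr (pow_succ _ _).symm hav'⟩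

/-! ## §3 The witness -/

/-- **THE UPPER SIDE OF THE DIAL**: for every notch `w` with `2t ≤ w + 1` and every ambient degree
`d ≥ 2t` there is a fan-in-two noncommutative circuit of size `≤ 5t + j + 1` computing `PAL_t^{j+2}`
and satisfying Def. 5.6 read semantically with `δ = w + 1` — at every product gate one operand's
value has all components of degrees `w + 2 ≤ b ≤ d + 1` equal to zero — over every commutative
semiring. [cite: LimayeMalodSrinivasan2016, §1 (remark on `PAL²`), Def. 5.6] -/
theorem exists_unbalanced_palPow (t j : ℕ) {w d : ℕ} (hw : 2 * t ≤ w + 1) (htd : 2 * t ≤ d) :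
    ∃ P : ArithCircuit R (Fin 2), P.IsFanInTwo ∧
      (∀ (l₁ : List (Gate R (Fin 2))) (o o' : Operand R (Fin 2)) (l₂ : List (Gate R (Fin 2))),
        P.gates = l₁ ++ Gate.prod [o, o'] :: l₂ →
          (∀ b : ℕ, w + 2 ≤ b → b ≤ d + 1 → degPart d b (o.ncEval (ncGateValues l₁)) = 0) ∨
          (∀ b : ℕ, w + 2 ≤ b → b ≤ d + 1 → degPart d b (o'.ncEval (ncGateValues l₁)) = 0)) ∧
      P.ncEval = palPoly R t ^ (j + 2) ∧ P.size ≤ 5 * t + (j + 1) := by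
  obtain ⟨gs, h2, hd, hlen, -, u, -, hval⟩ := avail_palPow R hw htd (j + 1)
  refine ⟨⟨gs, u⟩, h2, hd, ?_, ?_⟩
  · show u.ncEval (ncGateValues gs) = palPoly R t ^ (j + 1 + 1)
    exact hval
  · show gs.length ≤ 5 * t + (j + 1)
    exact hlen

end Build

/-! ## §4 The dial is strict -/

section Dial

variable (K : Type u) [Field K]

/-- **THE UNBALANCE DIAL IS STRICT** (both sides, every field, `t = s + 1 ≥ 1`, every power
`k = j + 2`, degree `d = 2(s+1)j + 4(s+1)`): (1) SOME fan-in-two circuit of size `≤ 5(s+1) + j + 1`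
computes `PAL_{s+1}^{j+2}` with Def. 5.6 (semantic, `δ = 2s + 2`) at every product gate; (2) EVERY
fan-in-two circuit computing it with Def. 5.6 (semantic, `δ = w + 1`) has
`2^{s+1} ≤ (s+2) · (w+1) 2^w · size`; (3) EVERY fan-in-two SKEW circuit computing it has
`2^{s+1} ≤ (s+2) · size`. In print for `j = 0` as the one-non-skew-gate separation.
[cite: LimayeMalodSrinivasan2016, §1 (remark on `PAL²`), Cor. 5.7, Thm 5.5] -/
theorem palPow_dial_two_sided (s j : ℕ) :
    (∃ P : ArithCircuit K (Fin 2), P.IsFanInTwo ∧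
      (∀ (l₁ : List (Gate K (Fin 2))) (o o' : Operand K (Fin 2)) (l₂ : List (Gate K (Fin 2))),
        P.gates = l₁ ++ Gate.prod [o, o'] :: l₂ →
          (∀ b : ℕ, (2 * s + 1) + 2 ≤ b → b ≤ 2 * (s + 1) * j + 4 * (s + 1) + 1 →
            degPart (2 * (s + 1) * j + 4 * (s + 1)) b (o.ncEval (ncGateValues l₁)) = 0) ∨
          (∀ b : ℕ, (2 * s + 1) + 2 ≤ b → b ≤ 2 * (s + 1) * j + 4 * (s + 1) + 1 →
            degPart (2 * (s + 1) * j + 4 * (s + 1)) b (o'.ncEval (ncGateValues l₁)) = 0)) ∧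
      P.ncEval = palPoly K (s + 1) ^ (j + 2) ∧ P.size ≤ 5 * (s + 1) + (j + 1)) ∧
    (∀ (w : ℕ) (P : ArithCircuit K (Fin 2)), P.IsFanInTwo →
      (∀ (l₁ : List (Gate K (Fin 2))) (o o' : Operand K (Fin 2)) (l₂ : List (Gate K (Fin 2))),
        P.gates = l₁ ++ Gate.prod [o, o'] :: l₂ →
          (∀ b : ℕ, w + 2 ≤ b → b ≤ 2 * (s + 1) * j + 4 * (s + 1) + 1 →
            degPart (2 * (s + 1) * j + 4 * (s + 1)) b (o.ncEval (ncGateValues l₁)) = 0) ∨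
          (∀ b : ℕ, w + 2 ≤ b → b ≤ 2 * (s + 1) * j + 4 * (s + 1) + 1 →
            degPart (2 * (s + 1) * j + 4 * (s + 1)) b (o'.ncEval (ncGateValues l₁)) = 0)) →
      P.ncEval = palPoly K (s + 1) ^ (j + 2) →
        2 ^ (s + 1) ≤ (s + 1 + 1) * ((w + 1) * 2 ^ w) * P.size) ∧
    (∀ P : ArithCircuit K (Fin 2), P.IsFanInTwo → P.IsSkew →
      P.ncEval = palPoly K (s + 1) ^ (j + 2) → 2 ^ (s + 1) ≤ (s + 1 + 1) * P.size) :=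
  ⟨exists_unbalanced_palPow K (s + 1) j (by omega) (by omega),
    fun _ P h2 hdeg h => palPow_degree K (by omega) P h2 hdeg h,
    fun P h2 hs h => palPow_skew K (by omega) P h2 hs h⟩

end Dial

end Summit.ValiantsHypothesis.ValiantsHypothesis.Theorems.NcPalindromePowerWitness

end
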